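/-
Copyright: the b2b-balaban T⁴-continuum CRUX team, row NE7b OWNER lineage `t4-ne7b-p1` (gen 141). Project licence.
-/
import Summits.QuantumFields.BalabanUV.T4Continuum.Spine.NE7b.SupKernelTaylorExtraction
import Summits.QuantumFields.BalabanUV.T4Continuum.Spine.NE7b.SupWhitenedFirstOrderLetters

/-!
# SCHUR FOR TRILINEAR KERNELS: THE OPERATOR LETTER `κ₃` IS READ OFF THE FIXED-SLOT KERNEL LETTERS (SCOPING (d13)(1), fifth file).
# (433) §2 typed Schur's test at order 2 (rows and columns `≤ κ ⟹` Euclidean operator norm `≤ κ`).  At order 3: if the entries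
# `T_{xyz} = T[e_x,e_y,e_z]` of a continuous trilinear map on `ℝ^ι` have the slot-2 letter `Σ_{x,z}|T_{xyz}| ≤ L₂` (all `y`) and the slot-3
# letter `Σ_{x,y}|T_{xyz}| ≤ L₃` (all `z`), then
#   `|T[φ,h,k]| ≤ √(L₂L₃)·‖φ‖·‖h‖·‖k‖`,  i.e.  `‖T‖ ≤ √(L₂L₃)`
# (`|φ_x| ≤ ‖φ‖`, then the weighted Cauchy–Schwarz `Σ_{y,z}S_{yz}|h_y||k_z| ≤ √(L₂L₃)‖h‖‖k‖` for `S_{yz} = Σ_x|T_{xyz}|`, whose rows are the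
# slot-2 sums and whose columns are the slot-3 sums) — so the class's operator letter `‖U‴‖ ≤ κ₃` for the OUTPUT is READ OFF (480)'s letters of
# the entry majorant and (426)'s Brascamp–Lieb route (stated for `M ≻ 0`) need not be restated for a general `Γ` (row NE7b, node U5c; (438)
# `expand_first_slot`, (456) `expand_two_slots`, Mathlib's `Finset.sum_sq_le_sum_mul_sum_of_sq_le_mul`, `PiLp.norm_apply_le` BY NAME; [folklore])

Cell `pub-balaban`, sub-cell `t4`, spine estimate NE7b (`T4WeightBudget.RelWeightBound`; the cell's OWN estimate — NOT PRINTED in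
[Bałaban 1983–89], NOT PROVED).  Crux-route work under `Spine/NE7b/` by the row OWNER (`t4-ne7b-p1` gen 141, file (481)) under FREEZE
(0)'s crux-prover clause; NOTHING of Bałaban's is named as a Lean object, valued or asserted; no `T4Continuum/Support` leaf typed; no
`def`, no notation; zero `sorry`.  Imports (BY NAME): the OWNER's (438) `…SupKernelTaylorExtraction` (`expand_first_slot`), (456)
`…SupWhitenedFirstOrderLetters` (`expand_two_slots`).

WHAT IS PROVED ([folklore]; `ι` finite):
* §1 `weighted_cauchy_schwarz_sq`, `weighted_cauchy_schwarz` (`Σ_{y,z}S_{yz}|h_y||k_z| ≤ √(L₂L₃)‖h‖‖k‖` for `S ≥ 0` with rows `≤ L₂`, columns `≤ L₃`).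
* §2 `trilinear_kernel_sum_le` (`|Σ_{x,y,z}φ_xh_yk_zT_{xyz}| ≤ √(L₂L₃)‖φ‖‖h‖‖k‖` for a scalar kernel with the two slot letters).
* §3 `trilinear_expand` (`T[φ,h,k] = Σ_{x,y,z}φ_xh_yk_z·T[e_x,e_y,e_z]`), THE END **`opNorm_le_of_slot_letters`** (`‖T‖ ≤ √(L₂L₃)`); §4 toy.

HONEST (what this is NOT).  Finite-dimensional linear algebra; which two slots are summed is a choice (any two of the three fixed-slot letters
give a bound); the class-map packaging is the next file; scalar skeleton ((A3), NC-NE7b-α UNRULED); nothing of Bałaban's asserted.  BY-NAME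
EFFECT ON THE WALL: NONE.  NE7b NOT PRINTED ∕ NOT PROVED; spine PROVED 0∕9; rung (B)+1 — the programme's measures remain FINITE-torus
statements; NOT the mass gap, NOT Clay.  HONEST DEPENDENCY: continuum YM on T⁴ ⇐ BetaPertH ∧ nine spine estimates (0∕9 proved);
BetaPertH ⇐ (D1) ∧ (D4) ∧ CAP+tail; G-an2-4 gates asym, D1 and NE2∕3∕4.
-/

set_option autoImplicit false
set_option maxSynthPendingDepth 3

noncomputable section

namespace Summit.QuantumFields.BalabanUV.T4Continuum.NE7b.SupKernelSchurTrilinear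

open Real Finset
open scoped BigOperators
open SupKernelTaylorExtraction (expand_first_slot)
open SupWhitenedFirstOrderLetters (expand_two_slots)

variable {ι : Type} [Fintype ι]

/-! ## §1. The weighted Cauchy–Schwarz inequality -/

/-- **Weighted Cauchy–Schwarz, squared**: for `S ≥ 0` with rows `Σ_zS_{yz} ≤ L₂` and columns `Σ_yS_{yz} ≤ L₃`,
`(Σ_{y,z}S_{yz}|h_y||k_z|)² ≤ (L₂Σ_yh_y²)·(L₃Σ_zk_z²)`. [folklore] -/
theorem weighted_cauchy_schwarz_sq (S : ι → ι → ℝ) {L₂ L₃ : ℝ} (hS : ∀ y z, 0 ≤ S y z) (hrow : ∀ y, ∑ z, S y z ≤ L₂)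
    (hcol : ∀ z, ∑ y, S y z ≤ L₃) (h k : ι → ℝ) :
    (∑ y, ∑ z, S y z * |h y| * |k z|) ^ 2 ≤ (L₂ * ∑ y, h y ^ 2) * (L₃ * ∑ z, k z ^ 2) := by
  -- Cauchy–Schwarz over the pair index with `f = S h²`, `g = S k²`, `r = S|h||k|`
  have hcs := Finset.sum_sq_le_sum_mul_sum_of_sq_le_mul (Finset.univ : Finset (ι × ι)) (r := fun p => S p.1 p.2 * |h p.1| * |k p.2|)
    (f := fun p => S p.1 p.2 * h p.1 ^ 2) (g := fun p => S p.1 p.2 * k p.2 ^ 2) (fun p _ => mul_nonneg (hS p.1 p.2) (sq_nonneg _))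
    (fun p _ => mul_nonneg (hS p.1 p.2) (sq_nonneg _)) (fun p _ => by rw [mul_pow, mul_pow, sq_abs, sq_abs]; exact le_of_eq (by ring))
  rw [Fintype.sum_prod_type, Fintype.sum_prod_type, Fintype.sum_prod_type] at hcs
  -- the two marginals
  have hf : ∑ y, ∑ z, S y z * h y ^ 2 ≤ L₂ * ∑ y, h y ^ 2 := by
    calc ∑ y, ∑ z, S y z * h y ^ 2 = ∑ y, h y ^ 2 * ∑ z, S y z := Finset.sum_congr rfl fun y _ => by
          rw [Finset.mul_sum]
          exact Finset.sum_congr rfl fun z _ => by ring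
      _ ≤ ∑ y, h y ^ 2 * L₂ := Finset.sum_le_sum fun y _ => mul_le_mul_of_nonneg_left (hrow y) (sq_nonneg _)
      _ = L₂ * ∑ y, h y ^ 2 := by rw [← Finset.sum_mul]; ring
  have hg : ∑ y, ∑ z, S y z * k z ^ 2 ≤ L₃ * ∑ z, k z ^ 2 := by
    rw [Finset.sum_comm]
    calc ∑ z, ∑ y, S y z * k z ^ 2 = ∑ z, k z ^ 2 * ∑ y, S y z := Finset.sum_congr rfl fun z _ => by
          rw [Finset.mul_sum]
          exact Finset.sum_congr rfl fun y _ => by ring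
      _ ≤ ∑ z, k z ^ 2 * L₃ := Finset.sum_le_sum fun z _ => mul_le_mul_of_nonneg_left (hcol z) (sq_nonneg _)
      _ = L₃ * ∑ z, k z ^ 2 := by rw [← Finset.sum_mul]; ring
  have hf0 : 0 ≤ ∑ y, ∑ z, S y z * h y ^ 2 := Finset.sum_nonneg fun y _ => Finset.sum_nonneg fun z _ => mul_nonneg (hS y z) (sq_nonneg _)
  have hg0 : 0 ≤ ∑ y, ∑ z, S y z * k z ^ 2 := Finset.sum_nonneg fun y _ => Finset.sum_nonneg fun z _ => mul_nonneg (hS y z) (sq_nonneg _)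
  exact hcs.trans (mul_le_mul hf hg hg0 (hf0.trans hf))

/-- **Weighted Cauchy–Schwarz on `ℝ^ι`**: `Σ_{y,z}S_{yz}|h_y||k_z| ≤ √(L₂L₃)·‖h‖·‖k‖`. [folklore] -/
theorem weighted_cauchy_schwarz (S : ι → ι → ℝ) {L₂ L₃ : ℝ} (hS : ∀ y z, 0 ≤ S y z) (hrow : ∀ y, ∑ z, S y z ≤ L₂)
    (hcol : ∀ z, ∑ y, S y z ≤ L₃) (h k : EuclideanSpace ℝ ι) :
    ∑ y, ∑ z, S y z * |h y| * |k z| ≤ Real.sqrt (L₂ * L₃) * ‖h‖ * ‖k‖ := by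
  have hsq := weighted_cauchy_schwarz_sq S hS hrow hcol (fun y => h y) (fun z => k z)
  have hX : 0 ≤ ∑ y, ∑ z, S y z * |h y| * |k z| :=
    Finset.sum_nonneg fun y _ => Finset.sum_nonneg fun z _ => mul_nonneg (mul_nonneg (hS y z) (abs_nonneg _)) (abs_nonneg _)
  have e : (L₂ * ∑ y, h y ^ 2) * (L₃ * ∑ z, k z ^ 2) = L₂ * L₃ * (‖h‖ * ‖k‖) ^ 2 := by
    rw [mul_pow, EuclideanSpace.real_norm_sq_eq, EuclideanSpace.real_norm_sq_eq]; ring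
  rw [e] at hsq
  have hY : 0 ≤ ‖h‖ * ‖k‖ := mul_nonneg (norm_nonneg _) (norm_nonneg _)
  rcases le_or_gt 0 (L₂ * L₃) with hL | hL
  · calc ∑ y, ∑ z, S y z * |h y| * |k z| = Real.sqrt ((∑ y, ∑ z, S y z * |h y| * |k z|) ^ 2) := (Real.sqrt_sq hX).symm
      _ ≤ Real.sqrt (L₂ * L₃ * (‖h‖ * ‖k‖) ^ 2) := Real.sqrt_le_sqrt hsq
      _ = Real.sqrt (L₂ * L₃) * ‖h‖ * ‖k‖ := by rw [Real.sqrt_mul hL, Real.sqrt_sq hY, mul_assoc]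
  · -- `L₂L₃ < 0` forces the left side to vanish
    have h0 : (∑ y, ∑ z, S y z * |h y| * |k z|) ^ 2 ≤ 0 := hsq.trans (mul_nonpos_of_nonpos_of_nonneg hL.le (sq_nonneg _))
    have h1 : ∑ y, ∑ z, S y z * |h y| * |k z| = 0 := by nlinarith
    rw [h1]
    exact mul_nonneg (mul_nonneg (Real.sqrt_nonneg _) (norm_nonneg _)) (norm_nonneg _)

/-! ## §2. Scalar trilinear kernels -/

/-- **A trilinear kernel sum is bounded by the slot letters**: `Σ_{x,z}|T_{xyz}| ≤ L₂` (all `y`), `Σ_{x,y}|T_{xyz}| ≤ L₃` (all `z`) give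
`|Σ_{x,y,z}φ_xh_yk_zT_{xyz}| ≤ √(L₂L₃)·‖φ‖·‖h‖·‖k‖`. [folklore] -/
theorem trilinear_kernel_sum_le (T₃ : ι → ι → ι → ℝ) {L₂ L₃ : ℝ} (hs2 : ∀ y, ∑ x, ∑ z, |T₃ x y z| ≤ L₂) (hs3 : ∀ z, ∑ x, ∑ y, |T₃ x y z| ≤ L₃)
    (φ h k : EuclideanSpace ℝ ι) :
    |∑ x, ∑ y, ∑ z, φ x * h y * k z * T₃ x y z| ≤ Real.sqrt (L₂ * L₃) * ‖φ‖ * ‖h‖ * ‖k‖ := by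
  -- `|φ_x| ≤ ‖φ‖`
  have hφ : ∀ x, |φ x| ≤ ‖φ‖ := fun x => by rw [← Real.norm_eq_abs]; exact PiLp.norm_apply_le φ x
  -- the triangle inequality and the first slot
  have h1 : |∑ x, ∑ y, ∑ z, φ x * h y * k z * T₃ x y z| ≤ ∑ x, ∑ y, ∑ z, ‖φ‖ * (|T₃ x y z| * |h y| * |k z|) := by
    refine (Finset.abs_sum_le_sum_abs _ _).trans (Finset.sum_le_sum fun x _ => ?_)
    refine (Finset.abs_sum_le_sum_abs _ _).trans (Finset.sum_le_sum fun y _ => ?_)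
    refine (Finset.abs_sum_le_sum_abs _ _).trans (Finset.sum_le_sum fun z _ => ?_)
    rw [abs_mul, abs_mul, abs_mul]
    have hnn : 0 ≤ |T₃ x y z| * |h y| * |k z| := by positivity
    calc |φ x| * |h y| * |k z| * |T₃ x y z| = |φ x| * (|T₃ x y z| * |h y| * |k z|) := by ring
      _ ≤ ‖φ‖ * (|T₃ x y z| * |h y| * |k z|) := mul_le_mul_of_nonneg_right (hφ x) hnn
  -- the weighted Cauchy–Schwarz with `S_{yz} = Σ_x|T_{xyz}|`
  have h2 : ∑ x, ∑ y, ∑ z, ‖φ‖ * (|T₃ x y z| * |h y| * |k z|) = ‖φ‖ * ∑ y, ∑ z, (∑ x, |T₃ x y z|) * |h y| * |k z| := by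
    rw [Finset.mul_sum, Finset.sum_comm]
    refine Finset.sum_congr rfl fun y _ => ?_
    rw [Finset.mul_sum, Finset.sum_comm]
    refine Finset.sum_congr rfl fun z _ => ?_
    rw [Finset.sum_mul, Finset.sum_mul, Finset.mul_sum]
  have hrow : ∀ y, ∑ z, ∑ x, |T₃ x y z| ≤ L₂ := fun y => by rw [Finset.sum_comm]; exact hs2 y
  have hcol : ∀ z, ∑ y, ∑ x, |T₃ x y z| ≤ L₃ := fun z => by rw [Finset.sum_comm]; exact hs3 z
  have h3 := weighted_cauchy_schwarz (fun y z => ∑ x, |T₃ x y z|) (fun y z => Finset.sum_nonneg fun x _ => abs_nonneg _) hrow hcol h k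
  rw [h2] at h1
  calc |∑ x, ∑ y, ∑ z, φ x * h y * k z * T₃ x y z| ≤ ‖φ‖ * ∑ y, ∑ z, (∑ x, |T₃ x y z|) * |h y| * |k z| := h1
    _ ≤ ‖φ‖ * (Real.sqrt (L₂ * L₃) * ‖h‖ * ‖k‖) := mul_le_mul_of_nonneg_left h3 (norm_nonneg _)
    _ = Real.sqrt (L₂ * L₃) * ‖φ‖ * ‖h‖ * ‖k‖ := by ring

/-! ## §3. THE END: the operator letter of a trilinear map from its slot letters -/

section Operator

variable [DecidableEq ι]

/-- **The full coordinate expansion of a trilinear map**: `T[φ,h,k] = Σ_xΣ_yΣ_z φ_x·h_y·k_z·T[e_x,e_y,e_z]`. [folklore] -/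
theorem trilinear_expand (T : EuclideanSpace ℝ ι →L[ℝ] EuclideanSpace ℝ ι →L[ℝ] EuclideanSpace ℝ ι →L[ℝ] ℝ) (φ h k : EuclideanSpace ℝ ι) :
    T φ h k = ∑ x, ∑ y, ∑ z, φ x * h y * k z * T (EuclideanSpace.single x (1 : ℝ)) (EuclideanSpace.single y (1 : ℝ)) (EuclideanSpace.single z (1 :
        ℝ)) := by
  rw [expand_first_slot T φ h k]
  refine Finset.sum_congr rfl fun x _ => ?_
  rw [expand_two_slots (T (EuclideanSpace.single x (1 : ℝ))) h k, Finset.mul_sum]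
  refine Finset.sum_congr rfl fun y _ => ?_
  rw [Finset.mul_sum]
  exact Finset.sum_congr rfl fun z _ => by ring

/-- **THE END — SCHUR AT ORDER 3**: a continuous trilinear map on `ℝ^ι` whose entries have the slot-2 letter `Σ_{x,z}|T[e_x,e_y,e_z]| ≤ L₂` and
the slot-3 letter `Σ_{x,y}|T[e_x,e_y,e_z]| ≤ L₃` has operator norm `‖T‖ ≤ √(L₂L₃)`. [folklore] -/
theorem opNorm_le_of_slot_letters (T : EuclideanSpace ℝ ι →L[ℝ] EuclideanSpace ℝ ι →L[ℝ] EuclideanSpace ℝ ι →L[ℝ] ℝ) {L₂ L₃ : ℝ}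
    (hs2 : ∀ y, ∑ x, ∑ z, |T (EuclideanSpace.single x (1 : ℝ)) (EuclideanSpace.single y (1 : ℝ)) (EuclideanSpace.single z (1 : ℝ))| ≤ L₂)
    (hs3 : ∀ z, ∑ x, ∑ y, |T (EuclideanSpace.single x (1 : ℝ)) (EuclideanSpace.single y (1 : ℝ)) (EuclideanSpace.single z (1 : ℝ))| ≤ L₃) :
    ‖T‖ ≤ Real.sqrt (L₂ * L₃) := by
  have hC : 0 ≤ Real.sqrt (L₂ * L₃) := Real.sqrt_nonneg _
  refine ContinuousLinearMap.opNorm_le_bound _ hC fun φ => ?_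
  refine ContinuousLinearMap.opNorm_le_bound _ (mul_nonneg hC (norm_nonneg _)) fun h => ?_
  refine ContinuousLinearMap.opNorm_le_bound _ (mul_nonneg (mul_nonneg hC (norm_nonneg _)) (norm_nonneg _)) fun k => ?_
  rw [Real.norm_eq_abs, trilinear_expand T φ h k]
  exact trilinear_kernel_sum_le (fun x y z => T (EuclideanSpace.single x (1 : ℝ)) (EuclideanSpace.single y (1 : ℝ)) (EuclideanSpace.single z (1 : ℝ)))
    hs2 hs3 φ h k

end Operator

/-! ## §4. Toy -/

/-- Toy (§1 in numbers, `S = 1` on `Fin 1`): `(1·|1|·|1|)² ≤ (1·1²)(1·1²)`. -/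
example : ((1 : ℝ) * |(1 : ℝ)| * |(1 : ℝ)|) ^ 2 ≤ (1 * (1 : ℝ) ^ 2) * (1 * (1 : ℝ) ^ 2) := by norm_num

end Summit.QuantumFields.BalabanUV.T4Continuum.NE7b.SupKernelSchurTrilinear

end
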